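/-
Copyright: the b2b-balaban cell (near-miss cell 7), T⁴-continuum fan-out; row NE7b ROUND-2 swarm, seat
t4-ne7b-formalise-leaf-10 (gen 6) — supplier piece «T3b-READ» for the S6g′ INSTANCE's T3b (owner's rulings
R-OWNER-22-23 and R-OWNER-23-3∕-4∕-5; T3b holder leaf-05 g4): THE MEMBER'S PLACEMENT READING (journal OFFER
l.13598).  A supplier module consumed BY NAME; not a claim of T3b.  Released under the licence of the surrounding project.
-/
import Summits.QuantumFields.BalabanUV.T4Continuum.Support.HistoryAdmissible
import Summits.QuantumFields.BalabanUV.T4Continuum.Support.HistoryJoinsAdm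

/-!
# The member's placement READING: a physical genealogy placed on the addresses of its flat tree

Summits-side support leaf of the T⁴-continuum cell (rung (B)+1 on a FINITE torus only; NOT infinite volume, NOT the
mass gap, NOT the Clay statement; NOT a proof of the spine estimate NE7b).  Row NE7b, route «COUNT», row S6g′
INSTANCE, piece T3b (R-OWNER-22-23; holder leaf-05 g4) — the MEMBER side of the map «live component ↦ counted
placement», part 1 of 2 (part 2 `HistoryMemberPlacementRead`: the root value, the births' reading `bread`, the
join recursion `AllJoins`, the pedigree corollaries).  Built on leaf-09's census carrier `PGen` (`HistoryAdmissible`) and leaf-05 g2's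
placement carriers (`HistoryJoinsAdm`: `Addr D`, `evalA`, `rel`, `Junk`, `cfg`, `part`; `HistoryJoins.baddr`∕`rootAddr`∕
`clusterParts`∕`jparts`∕`croots`).  [folklore] structural recursion on `PGen`, list surgery, finset images; nothing is
quoted from print, nothing printed is asserted, no `[cite:]` tag, no `Prop`-valued fact minted (trigger c1): the four
definitions are DATA (`readAt`, `placed`, `naddr`, `subAt`).

WHY.  Under R-OWNER-23-5 (2) the T3b holder CHOOSES the physical reading `phys` of S12e's occupant key
(`HistoryAssemblyMultKey.keyOf`) and maps each occupant into leaf-05 g2's counted set `S zone ρ c₀ st (P.sortR.gen c) z`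
through leaf-02 g6's `HistoryJoinsRearrange.exists_rearranged_mem_S`, whose INPUT is a JUNK placement
`P : Addr D → γ′` of the flat tree satisfying `AllJoins c₀ st (PhysTop c₀ st zone) G P` and whose OUTPUT keeps the
births' reading `bread c₀ G P` and the root value.  So T3b must first READ THE MEMBER INTO SUCH A PLACEMENT: place the
datum `v label payload` of every birth of the physical genealogy `g : PGen γ` at that birth's address in the flat tree
`g.toGen`.  This file supplies that reading and its address bookkeeping, for an arbitrary value map `v : PEv → γ → ν`
(the instance's `valP K`, R-OWNER-23-4) and junk value `c₀ : ν`.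

WHAT (ns `…HistoryAdmissible.PGen`; `hD : ∀ a ∈ baddr g.toGen, a.length ≤ D` = «every birth address fits the space»,
leaf-02 g6's depth side condition, where marked).
* §1 **`readAt c₀ v g l`** (the datum at a raw address; junk off the births: `readAt_eq_of_not_mem`),
  **`placed c₀ v g : Addr D → ν`**, **`junk_placed : Junk g.toGen c₀ (placed c₀ v g)`** (no hypothesis), `placed_renew`,
  `evalA_placed` (hD), **`rel_false_placed_join`** ∕ **`rel_true_placed_join`** (the relative placement at the
  endpoint ∕ rest is the endpoint's ∕ rest's placement; depth of that partner only).
* §2 node addresses **`naddr g : Finset (List Bool)`** and sub-members **`subAt g a`** (renewal wrappers kept at the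
  target, skipped on the way down — the convention of `clusterParts`∕`jparts`), `append_mem_naddr`∕`subAt_append`,
  `readAt_append`, **`mem_baddr_subAt_iff`** (the sub-member's births are the suffixes), `depth_subAt`,
  **`rel_placed_subAt`** (hD; the relative placement at a node is the sub-member's placement),
  **`subAt_of_mem_clusterParts`** ∕ `subAt_of_mem_jparts` ∕ **`mem_naddr_of_mem_croots`** (the flat tree's cluster
  parts, top-join parts and joins sit at node addresses, the parts' trees being the sub-members' flat trees),
  **`cfg_placed_join`** (hD; leaf-05 g2's configuration of the top join read off the member's placement is the tuple of
  the part sub-members' placements), `toGen_subAt_part`, `depth_subAt_part`.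

HONEST SCOPE.  The member side only.  What stays T3b's (leaf-05 g4): the choice of `phys`∕`valP`, `PhysTop` at every
join from H3's `Realises` (touch0-connectedness from realised contact along `parts_sortR_perm`, distinct same-class
parts reading different births from `disjoint`), `hzone` for `zoneP` (leaf-02 g6's part 2‴), `hρ`, the template
factor and the image count into `koccOf`.  Nothing of H3∕(B)∕BetaPertH touched; `BirthShapeNodup`∕`resum`∕`hmult` NOT
retired by this file; NE7b NOT proved; spine 0∕9.  HONEST DEPENDENCY (cell): continuum YM on T⁴ ⇐ BetaPertH ∧ nine
spine estimates (0/9 proved); BetaPertH ⇐ (D1) ∧ (D4) ∧ CAP+tail; G-an2-4 gates asym, D1 and NE2/3/4.  This file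
changes none of it.
-/

open Finset
open Literature.MathematicalPhysics.QuantumFieldTheory.Balaban1983to89
open T4PersistenceDictionary
open Summit.QuantumFields.BalabanUV.T4Continuum.HistoryJoins
open Summit.QuantumFields.BalabanUV.T4Continuum.HistoryJoinsAdm

noncomputable section

namespace Summit.QuantumFields.BalabanUV.T4Continuum.HistoryAdmissible.PGen

variable {γ ν : Type*} {D : ℕ} (c₀ : ν) (v : PEv → γ → ν)

/-! ## §1 Reading a datum at an address; the placement read off the member -/

/-- **THE DATUM READ AT A RAW ADDRESS** of the member's flat tree: `v label payload` at the address of a birth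
(`false` = endpoint `X`, `true` = rest `Y`; renewals transparent), the junk value `c₀` at every other list. [folklore] -/
def readAt : PGen γ → List Bool → ν
  | birth j d z, [] => v ((j, 0, d) : PEv) z
  | birth _ _ _, _ :: _ => c₀
  | renew G _, l => readAt G l
  | join _ _ _, [] => c₀
  | join X _ _, false :: l => readAt X l
  | join _ Y _, true :: l => readAt Y l

/-- unfolding at a birth, empty address [folklore] -/
@[simp] theorem readAt_birth_nil (j d : ℕ) (z : γ) : readAt c₀ v (birth j d z) [] = v ((j, 0, d) : PEv) z := rfl

/-- unfolding at a birth, non-empty address [folklore] -/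
@[simp] theorem readAt_birth_cons (j d : ℕ) (z : γ) (b : Bool) (l : List Bool) :
    readAt c₀ v (birth j d z) (b :: l) = c₀ := rfl

/-- renewals are transparent [folklore] -/
@[simp] theorem readAt_renew (G : PGen γ) (h : ℕ) (l : List Bool) : readAt c₀ v (renew G h) l = readAt c₀ v G l := by
  cases l <;> rfl

/-- a join carries no datum at its own address [folklore] -/
@[simp] theorem readAt_join_nil (X Y : PGen γ) (s : ℕ) : readAt c₀ v (join X Y s) [] = c₀ := rfl

/-- descending into the endpoint [folklore] -/
@[simp] theorem readAt_join_false (X Y : PGen γ) (s : ℕ) (l : List Bool) :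
    readAt c₀ v (join X Y s) (false :: l) = readAt c₀ v X l := rfl

/-- descending into the rest [folklore] -/
@[simp] theorem readAt_join_true (X Y : PGen γ) (s : ℕ) (l : List Bool) :
    readAt c₀ v (join X Y s) (true :: l) = readAt c₀ v Y l := rfl

/-- **OFF THE BIRTH ADDRESSES THE READING IS JUNK.** [folklore] -/
theorem readAt_eq_of_not_mem : ∀ (g : PGen γ) (l : List Bool), l ∉ baddr g.toGen → readAt c₀ v g l = c₀
  | birth j d z, [], h => by simp [toGen, baddr] at h
  | birth _ _ _, _ :: _, _ => rfl
  | renew G hh, l, h => by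
      rw [readAt_renew]
      exact readAt_eq_of_not_mem G l (by simpa [toGen, baddr] using h)
  | join _ _ _, [], _ => rfl
  | join X Y s, false :: l, h => by
      rw [readAt_join_false]
      refine readAt_eq_of_not_mem X l fun hl => h ?_
      simp only [toGen, baddr, mem_union, mem_image]
      exact Or.inl ⟨l, hl, rfl⟩
  | join X Y s, true :: l, h => by
      rw [readAt_join_true]
      refine readAt_eq_of_not_mem Y l fun hl => h ?_
      simp only [toGen, baddr, mem_union, mem_image]
      exact Or.inr ⟨l, hl, rfl⟩

/-- **THE PLACEMENT READ OFF THE MEMBER** on the finite address space `Addr D`. [folklore] -/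
def placed (g : PGen γ) : Addr D → ν := fun a => readAt c₀ v g a.1

/-- unfolding [folklore] -/
@[simp] theorem placed_apply (g : PGen γ) (a : Addr D) : placed (D := D) c₀ v g a = readAt c₀ v g a.1 := rfl

/-- **THE MEMBER'S PLACEMENT IS JUNK OFF ITS BIRTHS** (leaf-05 g2's `Junk`) — no depth hypothesis. [folklore] -/
theorem junk_placed (g : PGen γ) : Junk g.toGen c₀ (placed (D := D) c₀ v g) :=
  fun r hr => readAt_eq_of_not_mem c₀ v g r.1 hr

/-- renewals are transparent for the placement [folklore] -/
@[simp] theorem placed_renew (G : PGen γ) (h : ℕ) : placed (D := D) c₀ v (renew G h) = placed c₀ v G := by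
  funext a; simp

/-- evaluation of the placement at a short raw address [folklore] -/
theorem evalA_placed_of_le (g : PGen γ) {l : List Bool} (hl : l.length ≤ D) :
    evalA c₀ (placed (D := D) c₀ v g) l = readAt c₀ v g l := by
  rw [evalA_of_le c₀ _ hl]; rfl

/-- **EVALUATION OF THE PLACEMENT AT ANY RAW ADDRESS** when every birth address fits the space: the reading.
[folklore] -/
theorem evalA_placed (g : PGen γ) (hD : ∀ a ∈ baddr g.toGen, a.length ≤ D) (l : List Bool) :
    evalA c₀ (placed (D := D) c₀ v g) l = readAt c₀ v g l := by
  by_cases hl : l.length ≤ D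
  · exact evalA_placed_of_le c₀ v g hl
  · rw [evalA, dif_neg hl, readAt_eq_of_not_mem c₀ v g l fun hmem => hl (hD l hmem)]

/-- the depth bound descends into the endpoint [folklore] -/
theorem depth_left {X Y : PGen γ} {s : ℕ} (hD : ∀ a ∈ baddr (join X Y s).toGen, a.length ≤ D) :
    ∀ a ∈ baddr X.toGen, a.length + 1 ≤ D := fun a ha => by
  have := hD (false :: a) (by simp only [toGen, baddr, mem_union, mem_image]; exact Or.inl ⟨a, ha, rfl⟩)
  simpa using this

/-- the depth bound descends into the rest [folklore] -/
theorem depth_right {X Y : PGen γ} {s : ℕ} (hD : ∀ a ∈ baddr (join X Y s).toGen, a.length ≤ D) :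
    ∀ a ∈ baddr Y.toGen, a.length + 1 ≤ D := fun a ha => by
  have := hD (true :: a) (by simp only [toGen, baddr, mem_union, mem_image]; exact Or.inr ⟨a, ha, rfl⟩)
  simpa using this

/-- the depth bound is kept by a renewal [folklore] -/
theorem depth_renew_iff {G : PGen γ} {h : ℕ} :
    (∀ a ∈ baddr (renew G h).toGen, a.length ≤ D) ↔ ∀ a ∈ baddr G.toGen, a.length ≤ D := Iff.rfl

/-- **THE RELATIVE PLACEMENT AT THE ENDPOINT IS THE ENDPOINT'S PLACEMENT** (depth: the endpoint's birth addresses,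
shifted once, fit the space). [folklore] -/
theorem rel_false_placed_join (X Y : PGen γ) (s : ℕ) (hX : ∀ a ∈ baddr X.toGen, a.length + 1 ≤ D) :
    rel c₀ [false] (placed (D := D) c₀ v (join X Y s)) = placed c₀ v X := by
  funext r
  simp only [rel, List.singleton_append, placed_apply]
  by_cases hl : (false :: r.1).length ≤ D
  · rw [evalA_of_le c₀ _ hl]; rfl
  · rw [evalA, dif_neg hl, readAt_eq_of_not_mem c₀ v X r.1 fun hmem => hl (by simpa using hX r.1 hmem)]

/-- **THE RELATIVE PLACEMENT AT THE REST IS THE REST'S PLACEMENT.** [folklore] -/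
theorem rel_true_placed_join (X Y : PGen γ) (s : ℕ) (hY : ∀ a ∈ baddr Y.toGen, a.length + 1 ≤ D) :
    rel c₀ [true] (placed (D := D) c₀ v (join X Y s)) = placed c₀ v Y := by
  funext r
  simp only [rel, List.singleton_append, placed_apply]
  by_cases hl : (true :: r.1).length ≤ D
  · rw [evalA_of_le c₀ _ hl]; rfl
  · rw [evalA, dif_neg hl, readAt_eq_of_not_mem c₀ v Y r.1 fun hmem => hl (by simpa using hY r.1 hmem)]

/-! ## §2 Node addresses, sub-members, and the parts of the top join -/

/-- **THE NODE ADDRESSES** of the member (data, as `baddr`): `[]` is the member itself; below a join `false` enters the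
endpoint and `true` the rest; renewals are transparent on the way DOWN (an address never stops inside a renewal chain
except at its top); a birth has no proper sub-node. [folklore] -/
def naddr : PGen γ → Finset (List Bool)
  | birth _ _ _ => {[]}
  | renew G _ => naddr G
  | join X Y _ => insert [] ((naddr X).image (List.cons false) ∪ (naddr Y).image (List.cons true))

/-- **THE SUB-MEMBER AT A NODE ADDRESS** (the member at `[]`; renewal wrappers KEPT at the target and SKIPPED on the
way down; below a birth, junk = the birth itself). [folklore] -/
def subAt : PGen γ → List Bool → PGen γ
  | g, [] => g
  | birth j d z, _ :: _ => birth j d z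
  | renew G _, b :: l => subAt G (b :: l)
  | join X _ _, false :: l => subAt X l
  | join _ Y _, true :: l => subAt Y l

/-- the empty address is a node [folklore] -/
@[simp] theorem nil_mem_naddr : ∀ g : PGen γ, [] ∈ naddr g
  | birth _ _ _ => by simp [naddr]
  | renew G _ => nil_mem_naddr G
  | join _ _ _ => by simp [naddr]

/-- the sub-member at the empty address is the member [folklore] -/
@[simp] theorem subAt_nil (g : PGen γ) : subAt g [] = g := by cases g <;> rfl

/-- a birth has no proper sub-node [folklore] -/
@[simp] theorem cons_mem_naddr_birth (j d : ℕ) (z : γ) (b : Bool) (l : List Bool) :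
    b :: l ∈ naddr (birth j d z) ↔ False := by
  simp [naddr]

/-- renewals are transparent on the way down [folklore] -/
@[simp] theorem naddr_renew (G : PGen γ) (h : ℕ) : naddr (renew G h) = naddr G := rfl

/-- renewals are transparent on the way down [folklore] -/
@[simp] theorem subAt_renew_cons (G : PGen γ) (h : ℕ) (b : Bool) (l : List Bool) :
    subAt (renew G h) (b :: l) = subAt G (b :: l) := rfl

/-- `false` enters the endpoint [folklore] -/
@[simp] theorem false_cons_mem_naddr_join (X Y : PGen γ) (s : ℕ) (l : List Bool) :
    false :: l ∈ naddr (join X Y s) ↔ l ∈ naddr X := by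
  simp [naddr]

/-- `true` enters the rest [folklore] -/
@[simp] theorem true_cons_mem_naddr_join (X Y : PGen γ) (s : ℕ) (l : List Bool) :
    true :: l ∈ naddr (join X Y s) ↔ l ∈ naddr Y := by
  simp [naddr]

/-- `false` enters the endpoint [folklore] -/
@[simp] theorem subAt_join_false (X Y : PGen γ) (s : ℕ) (l : List Bool) :
    subAt (join X Y s) (false :: l) = subAt X l := rfl

/-- `true` enters the rest [folklore] -/
@[simp] theorem subAt_join_true (X Y : PGen γ) (s : ℕ) (l : List Bool) :
    subAt (join X Y s) (true :: l) = subAt Y l := rfl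

/-- **NODE ADDRESSES COMPOSE.** [folklore] -/
theorem append_mem_naddr : ∀ {g : PGen γ} {a b : List Bool}, a ∈ naddr g → b ∈ naddr (subAt g a) → a ++ b ∈ naddr g
  | g, [], b, _, hb => by simpa using hb
  | birth _ _ _, _ :: _, _, ha, _ => by simp at ha
  | renew G h, c :: l, b, ha, hb => by
      rw [List.cons_append, naddr_renew, ← List.cons_append]
      exact append_mem_naddr (g := G) ha hb
  | join X Y s, false :: l, b, ha, hb => by
      rw [List.cons_append, false_cons_mem_naddr_join]
      exact append_mem_naddr (g := X) ((false_cons_mem_naddr_join X Y s l).1 ha) hb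
  | join X Y s, true :: l, b, ha, hb => by
      rw [List.cons_append, true_cons_mem_naddr_join]
      exact append_mem_naddr (g := Y) ((true_cons_mem_naddr_join X Y s l).1 ha) hb

/-- **SUB-MEMBERS COMPOSE.** [folklore] -/
theorem subAt_append : ∀ {g : PGen γ} {a : List Bool} (b : List Bool), a ∈ naddr g →
    subAt g (a ++ b) = subAt (subAt g a) b
  | g, [], b, _ => by simp
  | birth _ _ _, _ :: _, _, ha => by simp at ha
  | renew G h, c :: l, b, ha => by
      rw [List.cons_append, subAt_renew_cons, subAt_renew_cons, ← List.cons_append]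
      exact subAt_append (g := G) b ha
  | join X Y s, false :: l, b, ha => by
      rw [List.cons_append, subAt_join_false, subAt_join_false]
      exact subAt_append (g := X) b ((false_cons_mem_naddr_join X Y s l).1 ha)
  | join X Y s, true :: l, b, ha => by
      rw [List.cons_append, subAt_join_true, subAt_join_true]
      exact subAt_append (g := Y) b ((true_cons_mem_naddr_join X Y s l).1 ha)

/-- **READING BELOW A NODE IS READING THE SUB-MEMBER.** [folklore] -/
theorem readAt_append : ∀ {g : PGen γ} {a : List Bool} (l : List Bool), a ∈ naddr g →
    readAt c₀ v g (a ++ l) = readAt c₀ v (subAt g a) l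
  | g, [], l, _ => by simp
  | birth _ _ _, _ :: _, _, ha => by simp at ha
  | renew G h, c :: r, l, ha => by
      rw [List.cons_append, readAt_renew, subAt_renew_cons, ← List.cons_append]
      exact readAt_append (g := G) l ha
  | join X Y s, false :: r, l, ha => by
      rw [List.cons_append, readAt_join_false, subAt_join_false]
      exact readAt_append (g := X) l ((false_cons_mem_naddr_join X Y s r).1 ha)
  | join X Y s, true :: r, l, ha => by
      rw [List.cons_append, readAt_join_true, subAt_join_true]
      exact readAt_append (g := Y) l ((true_cons_mem_naddr_join X Y s r).1 ha)

/-- **THE BIRTH ADDRESSES OF A SUB-MEMBER ARE THE SUFFIXES** of the member's birth addresses through the node.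
[folklore] -/
theorem mem_baddr_subAt_iff : ∀ {g : PGen γ} {a : List Bool} (l : List Bool), a ∈ naddr g →
    (l ∈ baddr (subAt g a).toGen ↔ a ++ l ∈ baddr g.toGen)
  | g, [], l, _ => by simp
  | birth _ _ _, _ :: _, _, ha => by simp at ha
  | renew G h, c :: r, l, ha => by
      rw [subAt_renew_cons, mem_baddr_subAt_iff (g := G) l ha]; rfl
  | join X Y s, false :: r, l, ha => by
      rw [subAt_join_false, mem_baddr_subAt_iff (g := X) l ((false_cons_mem_naddr_join X Y s r).1 ha)]
      simp [toGen, baddr]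
  | join X Y s, true :: r, l, ha => by
      rw [subAt_join_true, mem_baddr_subAt_iff (g := Y) l ((true_cons_mem_naddr_join X Y s r).1 ha)]
      simp [toGen, baddr]

/-- the depth bound descends to sub-members (shifted by the node's depth) [folklore] -/
theorem depth_subAt {g : PGen γ} {a : List Bool} (ha : a ∈ naddr g) (hD : ∀ b ∈ baddr g.toGen, b.length ≤ D) :
    ∀ b ∈ baddr (subAt g a).toGen, b.length + a.length ≤ D := fun b hb => by
  have := hD (a ++ b) ((mem_baddr_subAt_iff b ha).1 hb)
  rw [List.length_append] at this; omega

/-- **THE RELATIVE PLACEMENT AT A NODE IS THE SUB-MEMBER'S PLACEMENT** (depth: the member's birth addresses fit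
the space). [folklore] -/
theorem rel_placed_subAt {g : PGen γ} {a : List Bool} (ha : a ∈ naddr g) (hD : ∀ b ∈ baddr g.toGen, b.length ≤ D) :
    rel c₀ a (placed (D := D) c₀ v g) = placed c₀ v (subAt g a) := by
  funext r
  simp only [rel, placed_apply]
  by_cases hl : (a ++ r.1).length ≤ D
  · rw [evalA_of_le c₀ _ hl, placed_apply, readAt_append c₀ v r.1 ha]
  · rw [evalA, dif_neg hl, readAt_eq_of_not_mem c₀ v (subAt g a) r.1 fun hmem => hl ?_]
    have := depth_subAt ha hD r.1 hmem
    rw [List.length_append]; omega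

/-- **THE STEP-`t` CLUSTER PARTS OF THE FLAT TREE SIT AT NODE ADDRESSES, THEIR TREES BEING THE SUB-MEMBERS' FLAT
TREES.** [folklore] -/
theorem subAt_of_mem_clusterParts (t : ℕ) : ∀ (g : PGen γ), ∀ q ∈ clusterParts PEv.step t g.toGen,
    q.1 ∈ naddr g ∧ (subAt g q.1).toGen = q.2
  | birth j d z, q, hq => by
      simp only [toGen, clusterParts_born, List.mem_singleton] at hq
      subst hq; exact ⟨nil_mem_naddr _, by simp [toGen]⟩
  | renew G h, q, hq => by
      simp only [toGen, clusterParts_renew, List.mem_singleton] at hq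
      subst hq; exact ⟨nil_mem_naddr _, by simp [toGen]⟩
  | join X Y s, q, hq => by
      by_cases hst : PEv.step ((s, 2, 0) : PEv) = t
      · simp only [toGen] at hq
        rw [clusterParts_merge_of_eq PEv.step hst, List.mem_append, List.mem_map, List.mem_map] at hq
        rcases hq with ⟨q', hq', rfl⟩ | ⟨q', hq', rfl⟩
        · exact ⟨(false_cons_mem_naddr_join X Y s _).2 (subAt_of_mem_clusterParts t X q' hq').1,
            by rw [subAt_join_false]; exact (subAt_of_mem_clusterParts t X q' hq').2⟩
        · exact ⟨(true_cons_mem_naddr_join X Y s _).2 (subAt_of_mem_clusterParts t Y q' hq').1,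
            by rw [subAt_join_true]; exact (subAt_of_mem_clusterParts t Y q' hq').2⟩
      · simp only [toGen] at hq
        rw [clusterParts_merge_of_ne PEv.step hst, List.mem_singleton] at hq
        subst hq; exact ⟨nil_mem_naddr _, by simp [toGen]⟩

/-- **THE PARTS OF THE TOP JOIN SIT AT NODE ADDRESSES.** [folklore] -/
theorem subAt_of_mem_jparts {g : PGen γ} {q : List Bool × Gen PEv} (hq : q ∈ jparts PEv.step g.toGen) :
    q.1 ∈ naddr g ∧ (subAt g q.1).toGen = q.2 := by
  cases g with
  | birth j d z => simp [toGen, jparts] at hq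
  | renew G h => simp [toGen, jparts] at hq
  | join X Y s =>
      have : q ∈ clusterParts PEv.step (PEv.step ((s, 2, 0) : PEv)) (join X Y s).toGen := by
        simpa [toGen, jparts] using hq
      exact subAt_of_mem_clusterParts _ (join X Y s) q this

/-- **THE JOINS OF THE FLAT TREE SIT AT NODE ADDRESSES** (every cluster root, at any depth). [folklore] -/
theorem mem_naddr_of_mem_crootsP : ∀ (o : Option ℕ) (g : PGen γ), ∀ q ∈ crootsP PEv.step o g.toGen, q.1 ∈ naddr g
  | o, birth j d z, q, hq => by simp [toGen, crootsP] at hq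
  | o, renew G h, q, hq => by
      rw [naddr_renew]
      exact mem_naddr_of_mem_crootsP none G q (by simpa [toGen, crootsP] using hq)
  | o, join X Y s, q, hq => by
      simp only [toGen, crootsP, List.mem_append, List.mem_map] at hq
      rcases hq with hq | ⟨q', hq', rfl⟩ | ⟨q', hq', rfl⟩
      · split_ifs at hq with ho
        · simp at hq
        · rw [List.mem_singleton] at hq
          subst hq; exact nil_mem_naddr _
      · exact (false_cons_mem_naddr_join X Y s _).2 (mem_naddr_of_mem_crootsP _ X q' hq')
      · exact (true_cons_mem_naddr_join X Y s _).2 (mem_naddr_of_mem_crootsP _ Y q' hq')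

/-- the joins of the flat tree sit at node addresses [folklore] -/
theorem mem_naddr_of_mem_croots {g : PGen γ} {q : List Bool × Gen PEv} (hq : q ∈ croots PEv.step g.toGen) :
    q.1 ∈ naddr g :=
  mem_naddr_of_mem_crootsP none g q hq

/-- **THE CONFIGURATION OF A JOIN'S TOP JOIN READ OFF THE MEMBER'S PLACEMENT IS THE TUPLE OF THE PART
SUB-MEMBERS' PLACEMENTS** (leaf-05 g2's `cfg`). [folklore] -/
theorem cfg_placed_join (X Y : PGen γ) (s : ℕ) (hD : ∀ b ∈ baddr (join X Y s).toGen, b.length ≤ D)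
    (i : Fin (npart PEv.step (Gen.merge X.toGen Y.toGen ((s, 2, 0) : PEv)))) :
    cfg c₀ PEv.step X.toGen Y.toGen ((s, 2, 0) : PEv) (placed (D := D) c₀ v (join X Y s)) i =
      placed c₀ v (subAt (join X Y s) (part PEv.step _ i).1) := by
  have hq := subAt_of_mem_jparts (g := join X Y s) (q := part PEv.step _ i) (part_mem PEv.step _ i)
  exact rel_placed_subAt c₀ v hq.1 hD

/-- … and each part's flat tree is the part sub-member's [folklore] -/
theorem toGen_subAt_part (X Y : PGen γ) (s : ℕ)
    (i : Fin (npart PEv.step (Gen.merge X.toGen Y.toGen ((s, 2, 0) : PEv)))) :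
    (subAt (join X Y s) (part PEv.step _ i).1).toGen = (part PEv.step _ i).2 :=
  (subAt_of_mem_jparts (g := join X Y s) (q := part PEv.step _ i) (part_mem PEv.step _ i)).2

/-- the depth bound for a part sub-member [folklore] -/
theorem depth_subAt_part (X Y : PGen γ) (s : ℕ) (hD : ∀ b ∈ baddr (join X Y s).toGen, b.length ≤ D)
    (i : Fin (npart PEv.step (Gen.merge X.toGen Y.toGen ((s, 2, 0) : PEv)))) :
    ∀ b ∈ baddr (subAt (join X Y s) (part PEv.step _ i).1).toGen, b.length ≤ D := fun b hb => by
  have hq := subAt_of_mem_jparts (g := join X Y s) (q := part PEv.step _ i) (part_mem PEv.step _ i)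
  have := depth_subAt hq.1 hD b hb
  omega

end Summit.QuantumFields.BalabanUV.T4Continuum.HistoryAdmissible.PGen

end
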